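import Literature.MathematicalPhysics.QuantumFieldTheory.Federbush1986.PlaquetteAverageV

/-!
# `Federbush1986.DecayEnvelope` — from [Federbush1987PhaseCellVI] Theorem 2's printed hypothesis «A_μ(x) and its first
# partial derivatives fall off at infinity faster than 1/x^{2+ε}» to polynomial radial envelopes: global bounds, the common
# antitone envelope of `‖A_μ‖`, `‖∂_νA_μ‖`, `‖F_μν‖`, `‖[A_μ,A_ν]‖`, and the integrability on `ℝ⁴` of its shifted square —
# the inputs of the assembly lemma `tendsto_plaqSum_of_expansion` (`PlaquetteSumLimit`)

statement-level skeleton of published theorems with citation tags; proofs where landed; nothing here is a claim about the Yang–Mills mass gap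

CITATION HEADER.  P. Federbush, *A phase cell approach to Yang–Mills theory. VI. Non-abelian lattice-continuum duality*,
Ann. Inst. H. Poincaré **47** (1987) 17–23 [Federbush1987PhaseCellVI], Theorem 2 p. 20: *«Let A_μ(x) be continuously
differentiable, and let A_μ(x) and its first partial derivatives fall off at infinity faster than 1/x^{2+ε}, some ε > 0,
i.e. ||x|^{2+ε}A_μ(x)| < c and likewise for the first derivatives. Then … the corresponding lattice actions, S^r_0,
converge to the continuum action as r → ∞.»*  Unit `lit-balaban-r17` gen 4 (fold owner of the Federbush block); SKELETON row
**F6.Thm2** of `run/shared/lean/pub/lit-balaban/lit-balaban-r17/SKELETON-r17.md` (end-game division of record, HOME/STATUS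
2026-08-21T06:17Z: r17 carrier-free analysis, r19 the `Theorem2Oriented` instantiation).

THE MATHEMATICS.  (i) A continuous `f : ℝ⁴ → V` with `‖x‖^p‖f(x)‖ < c` (`p ≥ 0`) satisfies `‖f(x)‖ ≤ K(1+‖x‖)^{−p}` for
all `x`, `K = 2^p·max(c, sup_{‖x‖≤1}‖f‖)` (compactness of the unit ball).  (ii) `t ↦ K(1 + max(t,0))^{−p}` is a
non-negative antitone radial profile («envelope»), equal to `K(1+‖x‖)^{−p}` at `t = ‖x‖`.  (iii) For `q > 4 = dim`,
`x ↦ (1 + max(‖x‖ − R, 0))^{−q}` is integrable on `ℝ⁴` (`≤ (1+R)^q(1+‖x‖)^{−q}`, Mathlib `integrable_one_add_norm`); hence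
squares and sums of squares of envelopes with `p > 2` shifted by any `R ≥ 0` are integrable — the shape
`(2g(‖x‖−6) + G(x))²` required by `tendsto_plaqSum_of_expansion`.  (iv) For a `C¹` potential with the printed decay:
global bounds `B₁ = B₂ = K`, `‖F_μν‖ ≤ 2K(1+‖x‖)^{−(2+ε)}`, and for any map `B` with `‖B X Y‖ ≤ L‖X‖‖Y‖` (the Lie bracket
on the finite-dimensional 𝔤) `‖B(A_μ, A_ν)‖ ≤ LK²(1+‖x‖)^{−(2+ε)}`.

WHAT THIS MODULE PROVIDES (plumbing def `polyEnvelope`; no `Prop` definition, no named fact; axioms standard):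
`polyEnvelope_nonneg`, `polyEnvelope_antitone`, `polyEnvelope_mono_left`, `polyEnvelope_norm`,
**`exists_polyDecay_bound`**, **`integrable_one_add_max_rpow`**, **`integrable_polyEnvelope_sum_sq`**, `norm_curlV_le_of_decay`,
`norm_bilin_le_of_decay`, **`decay_package`** (VI Theorem 2's hypothesis ⇒ `K`, global bounds, decay of `A`, `∂A`, `F`).
-/

namespace Literature.MathematicalPhysics.QuantumFieldTheory.Federbush1986

noncomputable section

open MeasureTheory Filter Set
open scoped Topology BigOperators

/-! ## §1 The polynomial radial envelope -/

/-- The polynomial radial envelope `K(1 + max(t,0))^{−p}` («fall off at infinity faster than 1/x^{2+ε}»).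
[cite: Federbush1987PhaseCellVI, Theorem 2 p. 20] -/
def polyEnvelope (K p : ℝ) (t : ℝ) : ℝ := K * (1 + max t 0) ^ (-p)

/-- [folklore] -/
private theorem one_add_max_pos (t : ℝ) : 0 < 1 + max t 0 := by positivity

/-- The envelope is non-negative for `K ≥ 0`. [cite: Federbush1987PhaseCellVI, Theorem 2 p. 20] -/
theorem polyEnvelope_nonneg {K : ℝ} (hK : 0 ≤ K) (p t : ℝ) : 0 ≤ polyEnvelope K p t :=
  mul_nonneg hK (Real.rpow_nonneg (one_add_max_pos t).le _)

/-- The envelope is antitone for `K ≥ 0`, `p ≥ 0`. [cite: Federbush1987PhaseCellVI, Theorem 2 p. 20] -/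
theorem polyEnvelope_antitone {K p : ℝ} (hK : 0 ≤ K) (hp : 0 ≤ p) : Antitone (polyEnvelope K p) := by
  intro t₁ t₂ ht
  unfold polyEnvelope
  refine mul_le_mul_of_nonneg_left ?_ hK
  refine Real.rpow_le_rpow_of_nonpos (one_add_max_pos t₁) ?_ (by linarith)
  have : max t₁ 0 ≤ max t₂ 0 := max_le_max ht le_rfl
  linarith

/-- The envelope is monotone in the constant. [cite: Federbush1987PhaseCellVI, Theorem 2 p. 20] -/
theorem polyEnvelope_mono_left {K K' : ℝ} (h : K ≤ K') (p t : ℝ) : polyEnvelope K p t ≤ polyEnvelope K' p t :=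
  mul_le_mul_of_nonneg_right h (Real.rpow_nonneg (one_add_max_pos t).le _)

/-- At `t = ‖x‖` the envelope is `K(1+‖x‖)^{−p}`. [cite: Federbush1987PhaseCellVI, Theorem 2 p. 20] -/
theorem polyEnvelope_norm {W : Type*} [SeminormedAddCommGroup W] (K p : ℝ) (x : W) :
    polyEnvelope K p ‖x‖ = K * (1 + ‖x‖) ^ (-p) := by
  unfold polyEnvelope; rw [max_eq_left (norm_nonneg x)]

/-- `(1 + ‖x‖)^{−p} ≤ 1` for `p ≥ 0`. [folklore] -/
private theorem rpow_neg_le_one {W : Type*} [SeminormedAddCommGroup W] {p : ℝ} (hp : 0 ≤ p) (x : W) :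
    (1 + ‖x‖) ^ (-p) ≤ 1 :=
  Real.rpow_le_one_of_one_le_of_nonpos (by linarith [norm_nonneg x]) (by linarith)

/-! ## §2 Decay hypothesis ⇒ polynomial bound -/

section Decay

variable {V : Type*} [NormedAddCommGroup V]

/-- **«||x|^{2+ε}f(x)| < c» ⇒ `‖f(x)‖ ≤ K(1+‖x‖)^{−p}`** for a continuous `f` (`p ≥ 0`), with `K ≥ 0` (the unit ball is
compact). [cite: Federbush1987PhaseCellVI, Theorem 2 p. 20] -/
theorem exists_polyDecay_bound {f : E4 → V} (hf : Continuous f) {p c : ℝ} (hp : 0 ≤ p)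
    (h : ∀ x, ‖x‖ ^ p * ‖f x‖ < c) : ∃ K, 0 ≤ K ∧ ∀ x, ‖f x‖ ≤ K * (1 + ‖x‖) ^ (-p) := by
  have hc : 0 < c := lt_of_le_of_lt (mul_nonneg (Real.rpow_nonneg (norm_nonneg _) _) (norm_nonneg _)) (h 0)
  obtain ⟨M, hM⟩ := (isCompact_closedBall (0 : E4) 1).exists_bound_of_continuousOn hf.continuousOn
  have hM0 : 0 ≤ M := (norm_nonneg _).trans (hM 0 (Metric.mem_closedBall_self zero_le_one))
  refine ⟨2 ^ p * max c M, by positivity, fun x => ?_⟩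
  have h1x : 0 < 1 + ‖x‖ := by positivity
  have hrpow : (1 + ‖x‖) ^ (-p) = ((1 + ‖x‖) ^ p)⁻¹ := Real.rpow_neg h1x.le p
  by_cases hx : ‖x‖ ≤ 1
  · -- inside the unit ball: `‖f x‖ ≤ M` and `2^p (1+‖x‖)^{−p} ≥ 1`
    have hfx : ‖f x‖ ≤ M := hM x (by simpa using hx)
    have h2 : 1 ≤ 2 ^ p * (1 + ‖x‖) ^ (-p) := by
      rw [hrpow, ← div_eq_mul_inv, one_le_div (Real.rpow_pos_of_pos h1x p)]
      exact Real.rpow_le_rpow h1x.le (by linarith) hp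
    calc ‖f x‖ ≤ max c M := hfx.trans (le_max_right _ _)
      _ ≤ max c M * (2 ^ p * (1 + ‖x‖) ^ (-p)) := le_mul_of_one_le_right (hc.le.trans (le_max_left _ _)) h2
      _ = 2 ^ p * max c M * (1 + ‖x‖) ^ (-p) := by ring
  · -- outside: `‖f x‖ < c/‖x‖^p ≤ c·2^p(1+‖x‖)^{−p}`
    have hx : 1 < ‖x‖ := lt_of_not_ge hx
    have hxp : 0 < ‖x‖ ^ p := Real.rpow_pos_of_pos (by linarith) p
    have hfx : ‖f x‖ ≤ c / ‖x‖ ^ p := by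
      rw [le_div_iff₀ hxp, mul_comm]; exact (h x).le
    have h3 : (1 + ‖x‖) ^ p ≤ 2 ^ p * ‖x‖ ^ p := by
      rw [← Real.mul_rpow (by norm_num) (norm_nonneg x)]
      exact Real.rpow_le_rpow h1x.le (by linarith) hp
    have h4 : c / ‖x‖ ^ p ≤ 2 ^ p * c * (1 + ‖x‖) ^ (-p) := by
      rw [hrpow, ← div_eq_mul_inv, div_le_div_iff₀ hxp (Real.rpow_pos_of_pos h1x p)]
      calc c * (1 + ‖x‖) ^ p ≤ c * (2 ^ p * ‖x‖ ^ p) := mul_le_mul_of_nonneg_left h3 hc.le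
        _ = 2 ^ p * c * ‖x‖ ^ p := by ring
    calc ‖f x‖ ≤ c / ‖x‖ ^ p := hfx
      _ ≤ 2 ^ p * c * (1 + ‖x‖) ^ (-p) := h4
      _ ≤ 2 ^ p * max c M * (1 + ‖x‖) ^ (-p) :=
          mul_le_mul_of_nonneg_right (mul_le_mul_of_nonneg_left (le_max_left c M) (Real.rpow_nonneg (by norm_num) p))
            (Real.rpow_nonneg h1x.le _)

end Decay

/-! ## §3 Integrability of shifted envelopes on `ℝ⁴` -/

/-- `1 + ‖x‖ ≤ (1 + R)(1 + max(‖x‖ − R, 0))` (`R ≥ 0`). [folklore] -/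
private theorem one_add_norm_le_mul_shift {R : ℝ} (hR : 0 ≤ R) (x : E4) :
    1 + ‖x‖ ≤ (1 + R) * (1 + max (‖x‖ - R) 0) := by
  by_cases h : ‖x‖ ≤ R
  · rw [max_eq_right (by linarith)]; linarith
  · have h : R < ‖x‖ := lt_of_not_ge h
    rw [max_eq_left (by linarith)]
    nlinarith [norm_nonneg x]

/-- **The shifted inverse power `(1 + max(‖x‖ − R, 0))^{−q}` is integrable on `ℝ⁴` for `q > 4`.**
[cite: Federbush1987PhaseCellVI, Theorem 2 p. 20] -/
theorem integrable_one_add_max_rpow {q : ℝ} (hq : 4 < q) {R : ℝ} (hR : 0 ≤ R) :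
    Integrable fun x : E4 => (1 + max (‖x‖ - R) 0) ^ (-q) := by
  have hdim : (Module.finrank ℝ E4 : ℝ) < q := by
    rw [finrank_euclideanSpace, Fintype.card_fin]; exact_mod_cast hq
  have hI : Integrable fun x : E4 => (1 + ‖x‖) ^ (-q) := integrable_one_add_norm hdim
  refine (hI.const_mul ((1 + R) ^ q)).mono' ?_ (Eventually.of_forall fun x => ?_)
  · refine (Continuous.rpow_const ?_ fun x => Or.inl (one_add_max_pos _).ne').aestronglyMeasurable
    exact continuous_const.add ((continuous_norm.sub continuous_const).max continuous_const)
  · have hb := one_add_max_pos (‖x‖ - R)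
    have h1x : 0 < 1 + ‖x‖ := by positivity
    have h1R : 0 < 1 + R := by positivity
    rw [Real.norm_eq_abs, abs_of_nonneg (Real.rpow_nonneg hb.le _)]
    -- (1 + max)^{-q} ≤ ((1+‖x‖)/(1+R))^{-q} = (1+R)^q (1+‖x‖)^{-q}
    have hle : (1 + ‖x‖) / (1 + R) ≤ 1 + max (‖x‖ - R) 0 := by
      rw [div_le_iff₀ h1R, mul_comm]; exact one_add_norm_le_mul_shift hR x
    have hq0 : -q ≤ 0 := by linarith
    calc (1 + max (‖x‖ - R) 0) ^ (-q) ≤ ((1 + ‖x‖) / (1 + R)) ^ (-q) :=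
          Real.rpow_le_rpow_of_nonpos (div_pos h1x h1R) hle hq0
      _ = (1 + R) ^ q * (1 + ‖x‖) ^ (-q) := by
          rw [Real.div_rpow h1x.le h1R.le, Real.rpow_neg h1R.le, div_inv_eq_mul, mul_comm]

/-- **Sums of shifted envelopes have integrable square** (`p > 2`): the shape `(2g(‖x‖−6) + G(x))²` required by
`tendsto_plaqSum_of_expansion` when both `g` and `G` are polynomial envelopes of exponent `p = 2 + ε`.
[cite: Federbush1987PhaseCellVI, Theorem 2 p. 20] -/
theorem integrable_polyEnvelope_sum_sq {K K' p R R' : ℝ} (hK : 0 ≤ K) (hK' : 0 ≤ K') (hp : 2 < p) (hR : 0 ≤ R)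
    (hR' : 0 ≤ R') :
    Integrable fun x : E4 => (polyEnvelope K p (‖x‖ - R) + polyEnvelope K' p (‖x‖ - R')) ^ 2 := by
  have h2p : 4 < 2 * p := by linarith
  have hsq : ∀ (L S : ℝ) (x : E4), 0 ≤ S → polyEnvelope L p (‖x‖ - S) ^ 2 = L ^ 2 * (1 + max (‖x‖ - S) 0) ^ (-(2 * p)) := by
    intro L S x _
    unfold polyEnvelope
    have e : ((1 + max (‖x‖ - S) 0) ^ (-p)) ^ 2 = (1 + max (‖x‖ - S) 0) ^ (-(2 * p)) := by
      rw [← Real.rpow_natCast ((1 + max (‖x‖ - S) 0) ^ (-p)) 2, ← Real.rpow_mul (one_add_max_pos _).le]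
      congr 1
      push_cast
      ring
    rw [mul_pow, e]
  have hI : Integrable fun x : E4 =>
      2 * (K ^ 2 * (1 + max (‖x‖ - R) 0) ^ (-(2 * p))) + 2 * (K' ^ 2 * (1 + max (‖x‖ - R') 0) ^ (-(2 * p))) :=
    (((integrable_one_add_max_rpow h2p hR).const_mul (K ^ 2)).const_mul 2).add
      (((integrable_one_add_max_rpow h2p hR').const_mul (K' ^ 2)).const_mul 2)
  refine hI.mono' ?_ (Eventually.of_forall fun x => ?_)
  · refine Continuous.aestronglyMeasurable ?_
    have hc : ∀ (L S : ℝ), Continuous fun x : E4 => polyEnvelope L p (‖x‖ - S) := by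
      intro L S
      unfold polyEnvelope
      refine continuous_const.mul (Continuous.rpow_const ?_ fun x => Or.inl (one_add_max_pos _).ne')
      exact continuous_const.add ((continuous_norm.sub continuous_const).max continuous_const)
    exact ((hc K R).add (hc K' R')).pow 2
  · have hu := polyEnvelope_nonneg hK p (‖x‖ - R)
    have hv := polyEnvelope_nonneg hK' p (‖x‖ - R')
    rw [Real.norm_eq_abs, abs_of_nonneg (sq_nonneg _), ← hsq K R x hR, ← hsq K' R' x hR']
    nlinarith [sq_nonneg (polyEnvelope K p (‖x‖ - R) - polyEnvelope K' p (‖x‖ - R'))]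

/-! ## §4 The package for a `C¹` potential with VI Theorem 2's decay -/

section Package

variable {V : Type*} [NormedAddCommGroup V] [NormedSpace ℝ V]

/-- Decay of the axis derivatives ⇒ the field strength `F_μν` decays with the doubled constant.
[cite: Federbush1987PhaseCellVI, Theorem 2 p. 20] -/
theorem norm_curlV_le_of_decay {A : E4 → Fin 4 → V} {K p : ℝ}
    (hD : ∀ x μ ν, ‖fderiv ℝ (fun y => A y μ) x (unitVec ν)‖ ≤ K * (1 + ‖x‖) ^ (-p)) (x : E4) (μ ν : Fin 4) :
    ‖curlV A μ ν x‖ ≤ polyEnvelope (2 * K) p ‖x‖ := by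
  rw [polyEnvelope_norm]
  unfold curlV
  calc _ ≤ ‖fderiv ℝ (fun y => A y ν) x (unitVec μ)‖ + ‖fderiv ℝ (fun y => A y μ) x (unitVec ν)‖ := norm_sub_le _ _
    _ ≤ K * (1 + ‖x‖) ^ (-p) + K * (1 + ‖x‖) ^ (-p) := add_le_add (hD x ν μ) (hD x μ ν)
    _ = 2 * K * (1 + ‖x‖) ^ (-p) := by ring

omit [NormedSpace ℝ V] in
/-- Decay of `A` ⇒ decay of any bounded bilinear expression in `A_μ, A_ν` (the commutator `[A_μ, A_ν]`), with constant
`L·K²` and the same exponent. [cite: Federbush1987PhaseCellVI, p. 18 («A∧A»), Theorem 2 p. 20] -/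
theorem norm_bilin_le_of_decay {A : E4 → Fin 4 → V} {K p : ℝ} (hK : 0 ≤ K) (hp : 0 ≤ p)
    (hA : ∀ x μ, ‖A x μ‖ ≤ K * (1 + ‖x‖) ^ (-p)) (B : V → V → V) {L : ℝ} (hL : 0 ≤ L)
    (hB : ∀ X Y, ‖B X Y‖ ≤ L * ‖X‖ * ‖Y‖) (x : E4) (μ ν : Fin 4) :
    ‖B (A x μ) (A x ν)‖ ≤ polyEnvelope (L * K ^ 2) p ‖x‖ := by
  rw [polyEnvelope_norm]
  have hr0 : 0 ≤ (1 + ‖x‖) ^ (-p) := Real.rpow_nonneg (by positivity) _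
  have hr1 : (1 + ‖x‖) ^ (-p) ≤ 1 := rpow_neg_le_one hp x
  have h1 := hA x μ
  have h2 := hA x ν
  calc ‖B (A x μ) (A x ν)‖ ≤ L * ‖A x μ‖ * ‖A x ν‖ := hB _ _
    _ ≤ L * (K * (1 + ‖x‖) ^ (-p)) * (K * (1 + ‖x‖) ^ (-p)) := by gcongr
    _ = L * K ^ 2 * (1 + ‖x‖) ^ (-p) * (1 + ‖x‖) ^ (-p) := by ring
    _ ≤ L * K ^ 2 * (1 + ‖x‖) ^ (-p) * 1 := by gcongr
    _ = L * K ^ 2 * (1 + ‖x‖) ^ (-p) := by ring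

/-- **VI Theorem 2's hypothesis, unpacked.**  For a `C¹` potential with «||x|^{2+ε}A_μ(x)| < c and likewise for the first
derivatives» (the hypothesis of `Theorem2Oriented`, same binder shape): one constant `K ≥ 0` bounding `A_μ` and the axis
derivatives globally (`B₁ = B₂ = K`) and through `K(1+‖x‖)^{−(2+ε)}`, and the envelope `polyEnvelope (2K) (2+ε)` of the
field strength. [cite: Federbush1987PhaseCellVI, Theorem 2 p. 20] -/
theorem decay_package {A : E4 → Fin 4 → V} (hA : ContDiff ℝ 1 A) {ε c : ℝ} (hε : 0 < ε)
    (hdec : ∀ x : E4, ∀ μ, ‖x‖ ^ (2 + ε) * ‖A x μ‖ < c ∧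
      ∀ ν, ‖x‖ ^ (2 + ε) * ‖fderiv ℝ (fun y => A y μ) x (unitVec ν)‖ < c) :
    ∃ K, 0 ≤ K ∧ (∀ x μ, ‖A x μ‖ ≤ K * (1 + ‖x‖) ^ (-(2 + ε))) ∧
      (∀ x μ ν, ‖fderiv ℝ (fun y => A y μ) x (unitVec ν)‖ ≤ K * (1 + ‖x‖) ^ (-(2 + ε))) ∧
      (∀ x μ, ‖A x μ‖ ≤ K) ∧ (∀ x μ ν, ‖fderiv ℝ (fun y => A y μ) x (unitVec ν)‖ ≤ K) ∧
      (∀ x μ ν, ‖curlV A μ ν x‖ ≤ polyEnvelope (2 * K) (2 + ε) ‖x‖) := by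
  have hp : (0 : ℝ) ≤ 2 + ε := by linarith
  have hAc : ∀ μ, ContDiff ℝ 1 (fun y => A y μ) := fun μ => contDiff_pi.1 hA μ
  -- per component bounds
  have hAμ : ∀ μ, ∃ K, 0 ≤ K ∧ ∀ x, ‖A x μ‖ ≤ K * (1 + ‖x‖) ^ (-(2 + ε)) := fun μ =>
    exists_polyDecay_bound (hAc μ).continuous hp fun x => (hdec x μ).1
  have hDμν : ∀ μ ν, ∃ K, 0 ≤ K ∧ ∀ x, ‖fderiv ℝ (fun y => A y μ) x (unitVec ν)‖ ≤ K * (1 + ‖x‖) ^ (-(2 + ε)) :=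
    fun μ ν => exists_polyDecay_bound (((hAc μ).continuous_fderiv one_ne_zero).clm_apply continuous_const) hp
      fun x => (hdec x μ).2 ν
  choose KA hKA0 hKA using hAμ
  choose KD hKD0 hKD using hDμν
  set K := max (Finset.univ.sup' Finset.univ_nonempty KA)
    (Finset.univ.sup' Finset.univ_nonempty fun q : Fin 4 × Fin 4 => KD q.1 q.2) with hKdef
  have hKA_le : ∀ μ, KA μ ≤ K := fun μ =>
    (Finset.le_sup' KA (Finset.mem_univ μ)).trans (le_max_left _ _)
  have hKD_le : ∀ μ ν, KD μ ν ≤ K := fun μ ν =>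
    (Finset.le_sup' (fun q : Fin 4 × Fin 4 => KD q.1 q.2) (Finset.mem_univ (μ, ν))).trans (le_max_right _ _)
  have hK0 : 0 ≤ K := (hKA0 0).trans (hKA_le 0)
  have hr0 : ∀ x : E4, 0 ≤ (1 + ‖x‖) ^ (-(2 + ε)) := fun x => Real.rpow_nonneg (by positivity) _
  have hr1 : ∀ x : E4, (1 + ‖x‖) ^ (-(2 + ε)) ≤ 1 := fun x => rpow_neg_le_one hp x
  have hA' : ∀ x μ, ‖A x μ‖ ≤ K * (1 + ‖x‖) ^ (-(2 + ε)) := fun x μ =>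
    (hKA μ x).trans (mul_le_mul_of_nonneg_right (hKA_le μ) (hr0 x))
  have hD' : ∀ x μ ν, ‖fderiv ℝ (fun y => A y μ) x (unitVec ν)‖ ≤ K * (1 + ‖x‖) ^ (-(2 + ε)) := fun x μ ν =>
    (hKD μ ν x).trans (mul_le_mul_of_nonneg_right (hKD_le μ ν) (hr0 x))
  refine ⟨K, hK0, hA', hD', fun x μ => ?_, fun x μ ν => ?_, fun x μ ν => norm_curlV_le_of_decay hD' x μ ν⟩
  · exact (hA' x μ).trans (by simpa using mul_le_mul_of_nonneg_left (hr1 x) hK0)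
  · exact (hD' x μ ν).trans (by simpa using mul_le_mul_of_nonneg_left (hr1 x) hK0)

end Package

end

end Literature.MathematicalPhysics.QuantumFieldTheory.Federbush1986
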